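import Literature.Computability.Cryptography.ChenQuantumLWEJointDatumOptimum
import Literature.Computability.Cryptography.ChenQuantumLWEDatumPrior

/-!
# The JOINT multi-run datum read-out under ANY prior on the unknown coordinates: the exact value (T16)

REPRODUCTION / ANALYSIS OF A CLAIMED RESULT UNDER ADJUDICATION (withdrawn): Yilei Chen, *Quantum
Algorithms for Lattice Problems*, IACR ePrint 2024/555, version of 2024-04-18 [ChenQuantumLattice2024]
(the version carrying the author's note that Step 9 contains a bug), Step 9 (§3.5.9, pp. 34–38) acting
on `|φ8.b⟩ = Σ_{j ∈ ℤ_P} e(-j²/P) |2D²j·b + v′ mod N⟩` (p. 35), `P = p₁Q`, `N = D²P`, and the repetition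
of the whole procedure over several runs with the SAME LWE secret (§3.6, p. 38).  Bundle
`papers/QuantumAdvantage/lwe-quantum-autopsy/`, Part 2 (`REPAIR-CENSUS.md` §1 theorem **T16** and §25),
on top of `ChenQuantumLWEJointDatumOptimum.lean` (T14: the joint class model, `POVM.prodFst`,
`siblings_normSq`) and `ChenQuantumLWEDatumPrior.lean` (T15: the diagonal lemma
`POVM.sum_weight_le_of_gram_diag`, the prior fibres `priorFiber`, the prior value `priorValue`, the
prior read-out `datumReadoutPrior`).
HONEST FRAMING: kernel-checked THEOREMS about a state occurring in a WITHDRAWN algorithm — here the EXACT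
VALUE of an information quantity for EVERY modulus, EVERY number of jointly measured runs AND EVERY PRIOR
on the unknown coordinates (how well ANY joint measurement of all the Step-9 registers can read the datum
one run consumes when the observer holds side information on the common secret), i.e. a decidable
verdict completing a precise NEGATIVE result; NOT summit progress, no cryptanalytic claim in either
direction, no new algorithm for any lattice problem; quantum lower bounds are out of scope.

## The question

T14 (`joint_datum_success_prob_isGreatest`) is the exact joint optimum `V(Q, m)` with NO prior on the
unknown coordinates (secret shift uniform); T15 (`datum_prior_isGreatest`) is the exact ONE-register
optimum `V_μ` under an ARBITRARY prior `μ`.  The runs of the algorithm share the secret, and in the LWE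
instances targeted the unknown coordinates are short, so the one clause of the datum census still "by
hand" (`REPAIR-CENSUS.md` §24.4 (vi); T15's docstring, "What is NOT here: several runs") is: under a
prior `μ` on the COMMON secret shift, can a joint — collective, entangling — measurement of the Step-9
registers of MANY runs read run `0`'s datum better than `V_μ`, e.g. by pooling what the siblings'
registers reveal about the short common secret with the prior?  No:

## What is proved (every `Q`, every finite `κ`, every weight `μ`; `P` odd, Cond. C.3)

The joint class is T11/T14's: run `0` (datum `a`, offset shift `c`) and sibling runs `k ∈ κ` (fresh
data `e k`, arbitrary fixed offsets `w k`), ONE secret shift `s` common to all runs, now WEIGHTED by an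
arbitrary `μ(s) ≥ 0` (`Σμ > 0`); `a`, `c`, `e` uniform (they are, Steps 1–8).
* **Upper bound** (`joint_datum_prior_success_prob_le_value`): for EVERY POVM on the joint registers
  `ℤ_N^{n+1} × (κ → ℤ_N^{n+1})` with outcomes in `ℤ_Q`, the `μ`-average probability of outputting run
  `0`'s datum is `≤ V_μ = (Σ_β max_g F_μ(β, g)) / ((Σ_s μ(s))·Q^{#U})` (`priorValue`, T15).  Mechanism
  (`prior_jointGram_eq`): the `μ`-weighted joint state given the datum is DIAGONAL in the fixed JOINT
  FRAME `W_{(β,r),e} = w_{β,r} ⊗ (⊗_k sibling_k(0, e_k))` (`jointBlockKet`: T13's block-twisted ket on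
  run `0`'s register times the siblings' kets at the REFERENCE secret shift `0`) with eigenvalue
  `Q^{n+1}·F_μ(β, a − r)` INDEPENDENT of `e` — because each sibling's register averaged over its own
  fresh data is the SAME operator for every secret (`ketGram_siblingKet`, T11; here `siblings_gram_eq`),
  so the siblings' factor can be rewritten at the reference secret and carries neither the datum nor the
  prior; T15's diagonal lemma then bounds every joint POVM.
* **Attainment** (`jointReadoutPrior` = T15's prior read-out on run `0` ⊗ identity on the siblings,
  `jointReadoutPrior_weight`, `joint_datum_prior_success_prob_eq_value`): with the Bayes guess table
  `ĝ(β) ∈ argmax_g F_μ(β, g)` it attains `V_μ` exactly.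
* Hence (`joint_datum_prior_isGreatest`, `joint_datum_prior_value_eq_single`,
  `Shape.joint_datum_privacy_prior`): for EVERY prior the joint optimum over ALL measurements of ALL the
  registers equals the one-register optimum `V_μ` of T15 — the siblings are worthless under every prior
  too, exactly.  `μ ≡ 1` is T14 (`priorValue_one_eq_datumValue`), a point mass gives `1`
  (`priorValue_single`).

Reading (census §25, rows G1/G2/G4/H1, §6 item (4)): whatever side information an observer holds on the
unknown coordinates and however many runs it measures jointly, the Step-9 registers are worth EXACTLY one
noiseless sample `(β, ⟨β, x_U⟩ mod Q)` of the unknown-coordinate vector per run whose datum is asked — the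
triage threshold for prior-exploiting, multi-run repair proposals is `V_μ`; every census verdict stands.

## What is NOT here

The law of `(a, c, e)` given the transcript (uniform and secret-independent: by hand, census §24 Lemma A,
from Steps 1–8); adaptive choices of later runs' offsets as functions of earlier outcomes beyond the class
model (T11's scope remark); the `q`-ary structure of the error-coordinate offsets (a computation on
PUBLIC data outside the class model, census §24/§25 row G7); any algorithm.

References: [ChenQuantumLattice2024] as above; [NielsenChuang2010] §2.2.6 p. 90 (POVMs), §2.4.1 p. 99
(reduced states of product states), Box 2.3 p. 87 (state discrimination); [Korobov1992] Ch. I §3 (Gauss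
sums, via T3/T13).
-/

namespace Literature.Computability.Cryptography.Chen2024

open scoped BigOperators ComplexOrder
open Matrix

/-! ### 1. Product kets: the squared norm factorises -/

section Tmul

variable {X Y : Type*} [Fintype X] [Fintype Y]

/-- `⟨φ ⊗ χ|φ ⊗ χ⟩ = ⟨φ|φ⟩·⟨χ|χ⟩`. [cite: NielsenChuang2010, §2.1.7 p. 73] -/
theorem star_tmul_dotProduct_tmul (φ : X → ℂ) (χ : Y → ℂ) :
    star (fun xy : X × Y => φ xy.1 * χ xy.2) ⬝ᵥ (fun xy : X × Y => φ xy.1 * χ xy.2)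
      = (star φ ⬝ᵥ φ) * (star χ ⬝ᵥ χ) := by
  unfold dotProduct
  rw [Fintype.sum_prod_type, Finset.sum_mul_sum]
  refine Finset.sum_congr rfl fun x _ => Finset.sum_congr rfl fun y _ => ?_
  simp only [Pi.star_apply, star_mul']
  ring

end Tmul

/-! ### 2. The joint frame and the prior-weighted joint state -/

section JointPrior

variable (n : ℕ) (D p₁ Q : ℕ+) {κ : Type*} [Fintype κ] [DecidableEq κ]

/-- **The siblings' factor is secret-free.**  Averaged over their own fresh data, the siblings'
registers give the product of the class twirls `Π_k ρ̄_{b, w k}(z_k, z′_k)` — the SAME for every secret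
shift `s` (`ketGram_siblingKet`, T11). [cite: ChenQuantumLattice2024, §3.5.9 p. 35, §3.6 p. 38;
NielsenChuang2010, §2.4.1 p. 99] -/
theorem siblings_gram_eq (U : Finset (Fin (n + 1))) (bk b : Fin (n + 1) → ℤ)
    (hbk : ∀ i, i ∉ U → bk i = b i) (w : κ → Fin (n + 1) → ℤ) (s : Fin (n + 1) → ZQ Q)
    (z z' : κ → (Fin (n + 1) → ZN D p₁ Q)) :
    ∑ e : κ → ZQ Q × (Fin (n + 1) → ZQ Q),
        (∏ k, siblingKet n D p₁ Q U bk b (w k) s (e k) (z k))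
          * (starRingEnd ℂ) (∏ k, siblingKet n D p₁ Q U bk b (w k) s (e k) (z' k))
      = ∏ k, twirledGram n D p₁ Q U bk b (w k) (z k) (z' k) := by
  have hterm : ∀ e : κ → ZQ Q × (Fin (n + 1) → ZQ Q),
      (∏ k, siblingKet n D p₁ Q U bk b (w k) s (e k) (z k))
          * (starRingEnd ℂ) (∏ k, siblingKet n D p₁ Q U bk b (w k) s (e k) (z' k))
        = ∏ k, (siblingKet n D p₁ Q U bk b (w k) s (e k) (z k)
            * (starRingEnd ℂ) (siblingKet n D p₁ Q U bk b (w k) s (e k) (z' k))) := by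
    intro e
    rw [map_prod, Finset.prod_mul_distrib]
  simp_rw [hterm]
  rw [(Fintype.prod_sum fun k (e' : ZQ Q × (Fin (n + 1) → ZQ Q)) =>
      siblingKet n D p₁ Q U bk b (w k) s e' (z k)
        * (starRingEnd ℂ) (siblingKet n D p₁ Q U bk b (w k) s e' (z' k))).symm]
  refine Finset.prod_congr rfl fun k _ => ?_
  rw [← ketGram_siblingKet n D p₁ Q U bk b (w k) hbk s (z k) (z' k)]
  rfl

/-- **The joint frame.**  `W_{(β,r),e}(u, z) = w_{β,r}(u) · Π_k sibling_k(0, e_k)(z_k)`: T13's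
block-twisted ket on run `0`'s register times the siblings' kets at the REFERENCE secret shift `0`
(built from `(U, bk, b|_{Uᶜ} = bk|_{Uᶜ}, v′, w)`; only its Gram matrix matters, and that is public by
`siblings_gram_eq`). [cite: ChenQuantumLattice2024, §3.5.9 pp. 35–37, §3.6 p. 38] -/
noncomputable def jointBlockKet (U : Finset (Fin (n + 1))) (bk b v' : Fin (n + 1) → ℤ)
    (w : κ → Fin (n + 1) → ℤ)
    (je : ((U → ZQ Q) × ZQ Q) × (κ → ZQ Q × (Fin (n + 1) → ZQ Q))) :
    (Fin (n + 1) → ZN D p₁ Q) × (κ → (Fin (n + 1) → ZN D p₁ Q)) → ℂ :=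
  fun x => blockKet n D p₁ Q U bk v' je.1 x.1
    * ∏ k, siblingKet n D p₁ Q U bk b (w k) 0 (je.2 k) (x.2 k)

/-- The squared norm of a joint frame vector: `c·(P·N^{n+1})^{#κ}` (`blockKet_orth`, `siblings_normSq`).
[cite: ChenQuantumLattice2024, §3.5.9 p. 35] -/
theorem jointBlockKet_normSq (hP : Odd ((p₁ * Q : ℕ+) : ℕ)) (U : Finset (Fin (n + 1)))
    (bk b v' : Fin (n + 1) → ℤ) (hunit : ∃ i₀, i₀ ∉ U ∧ IsUnit ((bk i₀ : ℤ) : ZQ Q))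
    (w : κ → Fin (n + 1) → ℤ)
    (je : ((U → ZQ Q) × ZQ Q) × (κ → ZQ Q × (Fin (n + 1) → ZQ Q))) :
    star (jointBlockKet n D p₁ Q U bk b v' w je) ⬝ᵥ jointBlockKet n D p₁ Q U bk b v' w je
      = (((blockConst n D p₁ Q U
          * ((((p₁ * Q : ℕ+) : ℕ) : ℝ) * (((D * D * (p₁ * Q) : ℕ+) : ℕ) : ℝ) ^ (n + 1))
              ^ Fintype.card κ) : ℝ) : ℂ) := by
  have h := star_tmul_dotProduct_tmul (blockKet n D p₁ Q U bk v' je.1)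
    (fun z : κ → (Fin (n + 1) → ZN D p₁ Q) => ∏ k, siblingKet n D p₁ Q U bk b (w k) 0 (je.2 k) (z k))
  rw [blockKet_orth n D p₁ Q hP U bk v' hunit, if_pos rfl, siblings_normSq n D p₁ Q hP U bk b w 0 je.2] at h
  refine h.trans ?_
  push_cast
  ring

/-- **The prior-weighted JOINT state given the datum is diagonal in the joint frame.**  For ANY weight
`μ` on the common secret shift:
`Σ_{(s,c),e} μ(s)·|joint(a,(s,c),e)⟩⟨joint(a,(s,c),e)| = Σ_{(β,r),e} Q^{n+1}·F_μ(β, a − r)·|W_{(β,r),e}⟩⟨W_{(β,r),e}|`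
entrywise — run `0`'s factor is T15's `prior_gram_eq`, the siblings' factor is secret-free
(`siblings_gram_eq`) and is rewritten at the reference secret; the eigenvalues do not depend on `e`.
[cite: ChenQuantumLattice2024, §3.5.9 pp. 35–38, §3.6 p. 38, eq. (12) p. 17; NielsenChuang2010, §2.4.1 p. 99] -/
theorem prior_jointGram_eq (U : Finset (Fin (n + 1))) (bk b v' : Fin (n + 1) → ℤ)
    (hb : ∀ i ∈ U, ((p₁ : ℕ) : ℤ) ∣ b i) (hbkU : ∀ i ∈ U, ((p₁ : ℕ) : ℤ) ∣ bk i)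
    (hbk : ∀ i, i ∉ U → bk i = b i) (w : κ → Fin (n + 1) → ℤ)
    (μ : (Fin (n + 1) → ZQ Q) → ℝ) (a : ZQ Q)
    (x x' : (Fin (n + 1) → ZN D p₁ Q) × (κ → (Fin (n + 1) → ZN D p₁ Q))) :
    ∑ i : ((Fin (n + 1) → ZQ Q) × (Fin (n + 1) → ZQ Q)) × (κ → ZQ Q × (Fin (n + 1) → ZQ Q)),
        (μ i.1.1 : ℂ)
          * (jointDatumKet n D p₁ Q U bk b v' w a i x
              * (starRingEnd ℂ) (jointDatumKet n D p₁ Q U bk b v' w a i x'))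
      = ∑ je : ((U → ZQ Q) × ZQ Q) × (κ → ZQ Q × (Fin (n + 1) → ZQ Q)),
          ((((((Q : ℕ+) : ℕ) : ℝ)) ^ (n + 1) * priorFiber n p₁ Q U bk b μ je.1.1 (a - je.1.2) : ℝ) : ℂ)
            * (jointBlockKet n D p₁ Q U bk b v' w je x
                * (starRingEnd ℂ) (jointBlockKet n D p₁ Q U bk b v' w je x')) := by
  -- both sides factor as (run-0 part) · (siblings' part)
  have hL : ∀ i : ((Fin (n + 1) → ZQ Q) × (Fin (n + 1) → ZQ Q)) × (κ → ZQ Q × (Fin (n + 1) → ZQ Q)),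
      (μ i.1.1 : ℂ)
          * (jointDatumKet n D p₁ Q U bk b v' w a i x
              * (starRingEnd ℂ) (jointDatumKet n D p₁ Q U bk b v' w a i x'))
        = (μ i.1.1 : ℂ) * (datumKet n D p₁ Q U bk b v' a i.1 x.1
            * (starRingEnd ℂ) (datumKet n D p₁ Q U bk b v' a i.1 x'.1))
          * ((∏ k, siblingKet n D p₁ Q U bk b (w k) i.1.1 (i.2 k) (x.2 k))
              * (starRingEnd ℂ) (∏ k, siblingKet n D p₁ Q U bk b (w k) i.1.1 (i.2 k) (x'.2 k))) := by
    intro i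
    unfold jointDatumKet
    rw [map_mul]
    ring
  have hR : ∀ je : ((U → ZQ Q) × ZQ Q) × (κ → ZQ Q × (Fin (n + 1) → ZQ Q)),
      ((((((Q : ℕ+) : ℕ) : ℝ)) ^ (n + 1) * priorFiber n p₁ Q U bk b μ je.1.1 (a - je.1.2) : ℝ) : ℂ)
          * (jointBlockKet n D p₁ Q U bk b v' w je x
              * (starRingEnd ℂ) (jointBlockKet n D p₁ Q U bk b v' w je x'))
        = ((((((Q : ℕ+) : ℕ) : ℝ)) ^ (n + 1) * priorFiber n p₁ Q U bk b μ je.1.1 (a - je.1.2) : ℝ) : ℂ)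
            * (blockKet n D p₁ Q U bk v' je.1 x.1 * (starRingEnd ℂ) (blockKet n D p₁ Q U bk v' je.1 x'.1))
          * ((∏ k, siblingKet n D p₁ Q U bk b (w k) 0 (je.2 k) (x.2 k))
              * (starRingEnd ℂ) (∏ k, siblingKet n D p₁ Q U bk b (w k) 0 (je.2 k) (x'.2 k))) := by
    intro je
    unfold jointBlockKet
    rw [map_mul]
    ring
  simp_rw [hL, hR]
  rw [Fintype.sum_prod_type]
  conv_rhs => rw [Fintype.sum_prod_type]
  dsimp only
  simp_rw [← Finset.mul_sum, siblings_gram_eq n D p₁ Q U bk b hbk w, ← Finset.sum_mul,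
    prior_gram_eq n D p₁ Q U bk b v' hb hbkU hbk μ a x.1 x'.1]

/-! ### 3. T16, upper bound: no joint measurement beats `V_μ`, whatever the prior -/

/-- **T16 (upper bound, weight form).**  For odd `P`, `b ≡ bk` off `U`, `b ≡ bk ≡ 0 (mod p₁)` on `U`, a
unit coordinate of `bk` off `U`, ANY weight `μ` on the common secret shift with block-fibre bound
`F_μ(β, g) ≤ M(β)`, and EVERY POVM on the JOINT Step-9 registers of run `0` and the sibling runs `κ`:
the `μ`-weighted total Born weight on "output = run 0's datum" (datum, offset shift, siblings' data
summed uniformly) is at most `Q^{n+2}·c·(Σ_β M(β)) · (Q^{n+2})^{#κ}·(P·N^{n+1})^{#κ}`.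
[cite: ChenQuantumLattice2024, §3.5.9 pp. 35–38, §3.6 p. 38, eq. (12) p. 17; NielsenChuang2010, §2.2.6 p. 90] -/
theorem joint_datum_prior_weight_le (hP : Odd ((p₁ * Q : ℕ+) : ℕ)) (U : Finset (Fin (n + 1)))
    (bk b v' : Fin (n + 1) → ℤ)
    (hb : ∀ i ∈ U, ((p₁ : ℕ) : ℤ) ∣ b i) (hbkU : ∀ i ∈ U, ((p₁ : ℕ) : ℤ) ∣ bk i)
    (hbk : ∀ i, i ∉ U → bk i = b i) (hunit : ∃ i₀, i₀ ∉ U ∧ IsUnit ((bk i₀ : ℤ) : ZQ Q))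
    (w : κ → Fin (n + 1) → ℤ) (μ : (Fin (n + 1) → ZQ Q) → ℝ) (M : (U → ZQ Q) → ℝ)
    (hM : ∀ β g, priorFiber n p₁ Q U bk b μ β g ≤ M β)
    (E : POVM ((Fin (n + 1) → ZN D p₁ Q) × (κ → (Fin (n + 1) → ZN D p₁ Q))) (ZQ Q)) :
    (∑ a, ∑ i : ((Fin (n + 1) → ZQ Q) × (Fin (n + 1) → ZQ Q)) × (κ → ZQ Q × (Fin (n + 1) → ZQ Q)),
        (μ i.1.1 : ℂ) * E.weight (jointDatumKet n D p₁ Q U bk b v' w a i) a).re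
      ≤ (((Q : ℕ+) : ℕ) : ℝ) ^ (n + 1) * (((Q : ℕ+) : ℕ) : ℝ) * blockConst n D p₁ Q U * (∑ β, M β)
        * (((((Q : ℕ+) : ℕ) : ℝ) * (((Q : ℕ+) : ℕ) : ℝ) ^ (n + 1)) ^ Fintype.card κ
          * ((((p₁ * Q : ℕ+) : ℕ) : ℝ) * (((D * D * (p₁ * Q) : ℕ+) : ℕ) : ℝ) ^ (n + 1))
              ^ Fintype.card κ) := by
  classical
  have hQ : (0 : ℝ) ≤ (((Q : ℕ+) : ℕ) : ℝ) ^ (n + 1) := by positivity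
  have h := POVM.sum_weight_le_of_gram_diag E (jointDatumKet n D p₁ Q U bk b v' w)
    (fun _ i => μ i.1.1) (jointBlockKet n D p₁ Q U bk b v' w)
    (fun a je => (((Q : ℕ+) : ℕ) : ℝ) ^ (n + 1) * priorFiber n p₁ Q U bk b μ je.1.1 (a - je.1.2))
    (fun je => (((Q : ℕ+) : ℕ) : ℝ) ^ (n + 1) * M je.1.1)
    (fun a je => mul_le_mul_of_nonneg_left (hM je.1.1 (a - je.1.2)) hQ)
    (fun a x x' => prior_jointGram_eq n D p₁ Q U bk b v' hb hbkU hbk w μ a x x')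
  refine h.trans (le_of_eq ?_)
  have hnorm : ∀ je : ((U → ZQ Q) × ZQ Q) × (κ → ZQ Q × (Fin (n + 1) → ZQ Q)),
      (star (jointBlockKet n D p₁ Q U bk b v' w je) ⬝ᵥ jointBlockKet n D p₁ Q U bk b v' w je).re
        = blockConst n D p₁ Q U
          * ((((p₁ * Q : ℕ+) : ℕ) : ℝ) * (((D * D * (p₁ * Q) : ℕ+) : ℕ) : ℝ) ^ (n + 1))
              ^ Fintype.card κ := by
    intro je
    rw [jointBlockKet_normSq n D p₁ Q hP U bk b v' hunit w je, Complex.ofReal_re]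
  simp_rw [hnorm]
  rw [Fintype.sum_prod_type]
  dsimp only
  simp only [Finset.sum_const, Finset.card_univ, nsmul_eq_mul]
  rw [Fintype.sum_prod_type]
  dsimp only
  simp only [Finset.sum_const, Finset.card_univ, Fintype.card_prod, Fintype.card_fun, ZMod.card,
    Fintype.card_fin, nsmul_eq_mul]
  simp only [Finset.mul_sum, Finset.sum_mul]
  refine Finset.sum_congr rfl fun β _ => ?_
  push_cast
  ring

/-- **The `μ`-weighted total weight of the joint class**:
`Q·Q^{n+1}·(Σ_s μ(s))·P·N^{n+1} · (Q^{n+2})^{#κ}·(P·N^{n+1})^{#κ}`.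
[cite: ChenQuantumLattice2024, §3.5.9 p. 35, §3.6 p. 38] -/
theorem joint_datum_prior_totalWeight (hP : Odd ((p₁ * Q : ℕ+) : ℕ)) (U : Finset (Fin (n + 1)))
    (bk b v' : Fin (n + 1) → ℤ) (w : κ → Fin (n + 1) → ℤ) (μ : (Fin (n + 1) → ZQ Q) → ℝ) :
    (∑ a : ZQ Q, ∑ i : ((Fin (n + 1) → ZQ Q) × (Fin (n + 1) → ZQ Q)) × (κ → ZQ Q × (Fin (n + 1) → ZQ Q)),
        (μ i.1.1 : ℂ) * (star (jointDatumKet n D p₁ Q U bk b v' w a i)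
          ⬝ᵥ jointDatumKet n D p₁ Q U bk b v' w a i)).re
      = (((Q : ℕ+) : ℕ) : ℝ) * (((Q : ℕ+) : ℕ) : ℝ) ^ (n + 1) * (∑ s, μ s)
          * ((((p₁ * Q : ℕ+) : ℕ) : ℝ) * (((D * D * (p₁ * Q) : ℕ+) : ℕ) : ℝ) ^ (n + 1))
        * (((((Q : ℕ+) : ℕ) : ℝ) * (((Q : ℕ+) : ℕ) : ℝ) ^ (n + 1)) ^ Fintype.card κ
          * ((((p₁ * Q : ℕ+) : ℕ) : ℝ) * (((D * D * (p₁ * Q) : ℕ+) : ℕ) : ℝ) ^ (n + 1))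
              ^ Fintype.card κ) := by
  have hC : ∀ (a : ZQ Q)
      (i : ((Fin (n + 1) → ZQ Q) × (Fin (n + 1) → ZQ Q)) × (κ → ZQ Q × (Fin (n + 1) → ZQ Q))),
      (μ i.1.1 : ℂ) * (star (jointDatumKet n D p₁ Q U bk b v' w a i)
          ⬝ᵥ jointDatumKet n D p₁ Q U bk b v' w a i)
        = ((μ i.1.1 * ((((p₁ * Q : ℕ+) : ℕ) : ℝ) * (((D * D * (p₁ * Q) : ℕ+) : ℕ) : ℝ) ^ (n + 1))
            ^ (Fintype.card κ + 1) : ℝ) : ℂ) := by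
    intro a i
    rw [jointDatumKet_normSq n D p₁ Q hP]
    push_cast
    ring
  simp_rw [hC, ← Complex.ofReal_sum]
  rw [Complex.ofReal_re, Finset.sum_const, Finset.card_univ, ZMod.card, nsmul_eq_mul, Fintype.sum_prod_type]
  dsimp only
  simp only [Finset.sum_const, Finset.card_univ, nsmul_eq_mul]
  rw [Fintype.sum_prod_type]
  dsimp only
  simp only [Finset.sum_const, Finset.card_univ, Fintype.card_prod, Fintype.card_fun, ZMod.card,
    Fintype.card_fin, nsmul_eq_mul]
  simp only [Finset.mul_sum, Finset.sum_mul]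
  refine Finset.sum_congr rfl fun s _ => ?_
  push_cast
  ring

/-- **T16 (probability form, upper bound).**  Under ANY prior `μ ≥ 0`, `Σμ > 0`, on the COMMON secret
shift (run `0`'s datum and offset shift and the siblings' data uniform), every POVM on the JOINT Step-9
registers of run `0` and of the sibling runs `κ` guesses run `0`'s datum with probability at most T15's
one-register prior value `V_μ`. [cite: ChenQuantumLattice2024, §3.5.9 pp. 35–38, §3.6 p. 38;
NielsenChuang2010, §2.2.6 p. 90, Box 2.3 p. 87] -/
theorem joint_datum_prior_success_prob_le_value (hP : Odd ((p₁ * Q : ℕ+) : ℕ))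
    (U : Finset (Fin (n + 1))) (bk b v' : Fin (n + 1) → ℤ)
    (hb : ∀ i ∈ U, ((p₁ : ℕ) : ℤ) ∣ b i) (hbkU : ∀ i ∈ U, ((p₁ : ℕ) : ℤ) ∣ bk i)
    (hbk : ∀ i, i ∉ U → bk i = b i) (hunit : ∃ i₀, i₀ ∉ U ∧ IsUnit ((bk i₀ : ℤ) : ZQ Q))
    (w : κ → Fin (n + 1) → ℤ) (μ : (Fin (n + 1) → ZQ Q) → ℝ) (hμ : 0 < ∑ s, μ s)
    (E : POVM ((Fin (n + 1) → ZN D p₁ Q) × (κ → (Fin (n + 1) → ZN D p₁ Q))) (ZQ Q)) :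
    (∑ a, ∑ i : ((Fin (n + 1) → ZQ Q) × (Fin (n + 1) → ZQ Q)) × (κ → ZQ Q × (Fin (n + 1) → ZQ Q)),
        (μ i.1.1 : ℂ) * E.weight (jointDatumKet n D p₁ Q U bk b v' w a i) a).re
        / (∑ a : ZQ Q,
            ∑ i : ((Fin (n + 1) → ZQ Q) × (Fin (n + 1) → ZQ Q)) × (κ → ZQ Q × (Fin (n + 1) → ZQ Q)),
            (μ i.1.1 : ℂ) * (star (jointDatumKet n D p₁ Q U bk b v' w a i)
              ⬝ᵥ jointDatumKet n D p₁ Q U bk b v' w a i)).re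
      ≤ priorValue n p₁ Q U bk b μ := by
  have hW := joint_datum_prior_weight_le n D p₁ Q hP U bk b v' hb hbkU hbk hunit w μ
    (fun β => Finset.univ.sup' Finset.univ_nonempty (priorFiber n p₁ Q U bk b μ β))
    (fun β g => Finset.le_sup' (priorFiber n p₁ Q U bk b μ β) (Finset.mem_univ g)) E
  have hQ : (0 : ℝ) < ((Q : ℕ+) : ℕ) := by exact_mod_cast PNat.pos Q
  have hP' : (0 : ℝ) < ((p₁ * Q : ℕ+) : ℕ) := by exact_mod_cast PNat.pos _
  have hN : (0 : ℝ) < ((D * D * (p₁ * Q) : ℕ+) : ℕ) := by exact_mod_cast PNat.pos _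
  have hT : (0 : ℝ) < ((((Q : ℕ+) : ℕ) : ℝ) * (((Q : ℕ+) : ℕ) : ℝ) ^ (n + 1)) ^ Fintype.card κ
      * ((((p₁ * Q : ℕ+) : ℕ) : ℝ) * (((D * D * (p₁ * Q) : ℕ+) : ℕ) : ℝ) ^ (n + 1))
          ^ Fintype.card κ :=
    mul_pos (pow_pos (mul_pos hQ (pow_pos hQ _)) _) (pow_pos (mul_pos hP' (pow_pos hN _)) _)
  rw [joint_datum_prior_totalWeight n D p₁ Q hP]
  unfold priorValue
  rw [div_le_div_iff₀
    (mul_pos (mul_pos (mul_pos (mul_pos hQ (pow_pos hQ _)) hμ) (mul_pos hP' (pow_pos hN _))) hT)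
    (mul_pos hμ (pow_pos hQ _))]
  calc (∑ a, ∑ i : ((Fin (n + 1) → ZQ Q) × (Fin (n + 1) → ZQ Q)) × (κ → ZQ Q × (Fin (n + 1) → ZQ Q)),
          (μ i.1.1 : ℂ) * E.weight (jointDatumKet n D p₁ Q U bk b v' w a i) a).re
          * ((∑ s, μ s) * (((Q : ℕ+) : ℕ) : ℝ) ^ U.card)
        ≤ ((((Q : ℕ+) : ℕ) : ℝ) ^ (n + 1) * (((Q : ℕ+) : ℕ) : ℝ) * blockConst n D p₁ Q U
              * (∑ β : U → ZQ Q, Finset.univ.sup' Finset.univ_nonempty (priorFiber n p₁ Q U bk b μ β))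
            * (((((Q : ℕ+) : ℕ) : ℝ) * (((Q : ℕ+) : ℕ) : ℝ) ^ (n + 1)) ^ Fintype.card κ
              * ((((p₁ * Q : ℕ+) : ℕ) : ℝ) * (((D * D * (p₁ * Q) : ℕ+) : ℕ) : ℝ) ^ (n + 1))
                  ^ Fintype.card κ))
          * ((∑ s, μ s) * (((Q : ℕ+) : ℕ) : ℝ) ^ U.card) :=
          mul_le_mul_of_nonneg_right hW (mul_pos hμ (pow_pos hQ _)).le
    _ = (∑ β : U → ZQ Q, Finset.univ.sup' Finset.univ_nonempty (priorFiber n p₁ Q U bk b μ β))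
          * ((((Q : ℕ+) : ℕ) : ℝ) * (((Q : ℕ+) : ℕ) : ℝ) ^ (n + 1) * (∑ s, μ s)
              * ((((p₁ * Q : ℕ+) : ℕ) : ℝ) * (((D * D * (p₁ * Q) : ℕ+) : ℕ) : ℝ) ^ (n + 1))
            * (((((Q : ℕ+) : ℕ) : ℝ) * (((Q : ℕ+) : ℕ) : ℝ) ^ (n + 1)) ^ Fintype.card κ
              * ((((p₁ * Q : ℕ+) : ℕ) : ℝ) * (((D * D * (p₁ * Q) : ℕ+) : ℕ) : ℝ) ^ (n + 1))
                  ^ Fintype.card κ)) := by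
          rw [← blockConst_mul_pow n D p₁ Q U]
          ring

/-! ### 4. T16, attainment: T15's prior read-out on run `0`, identity on the siblings -/

/-- **The joint prior read-out**: T15's prior datum read-out (Bayes guess table `ĝ`) on run `0`'s
register tensored with the identity on the siblings' registers — `E_a ⊗ 1`, built from PUBLIC data
`(U, bk, v′)` and `ĝ` only. [cite: ChenQuantumLattice2024, §3.5.9 pp. 35–38, §3.6 p. 38;
NielsenChuang2010, Box 2.3 p. 87, §2.4.1 p. 99] -/
noncomputable def jointReadoutPrior (hP : Odd ((p₁ * Q : ℕ+) : ℕ)) (U : Finset (Fin (n + 1)))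
    (bk v' : Fin (n + 1) → ℤ) (hunit : ∃ i₀, i₀ ∉ U ∧ IsUnit ((bk i₀ : ℤ) : ZQ Q))
    (ĝ : (U → ZQ Q) → ZQ Q) :
    POVM ((Fin (n + 1) → ZN D p₁ Q) × (κ → (Fin (n + 1) → ZN D p₁ Q))) (ZQ Q) :=
  (datumReadoutPrior n D p₁ Q hP U bk v' hunit ĝ).prodFst (κ → (Fin (n + 1) → ZN D p₁ Q))

/-- **Weights of the joint prior read-out on every joint member**: on `(a, ((s, c), e))` it outputs `a`
with Born weight exactly `c·#{β : 2τ(β, s) = ĝ(β)}·(P·N^{n+1})^{#κ}` (`datumReadoutPrior_weight` times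
the siblings' squared norm). [cite: ChenQuantumLattice2024, §3.5.9 pp. 35–38, §3.6 p. 38, eq. (12) p. 17;
NielsenChuang2010, §2.4.1 p. 99] -/
theorem jointReadoutPrior_weight (hP : Odd ((p₁ * Q : ℕ+) : ℕ)) (U : Finset (Fin (n + 1)))
    (bk b v' : Fin (n + 1) → ℤ)
    (hb : ∀ i ∈ U, ((p₁ : ℕ) : ℤ) ∣ b i) (hbkU : ∀ i ∈ U, ((p₁ : ℕ) : ℤ) ∣ bk i)
    (hbk : ∀ i, i ∉ U → bk i = b i) (hunit : ∃ i₀, i₀ ∉ U ∧ IsUnit ((bk i₀ : ℤ) : ZQ Q))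
    (w : κ → Fin (n + 1) → ℤ) (ĝ : (U → ZQ Q) → ZQ Q) (a : ZQ Q)
    (i : ((Fin (n + 1) → ZQ Q) × (Fin (n + 1) → ZQ Q)) × (κ → ZQ Q × (Fin (n + 1) → ZQ Q))) :
    (jointReadoutPrior n D p₁ Q hP U bk v' hunit ĝ).weight (jointDatumKet n D p₁ Q U bk b v' w a i) a
      = ((blockConst n D p₁ Q U : ℝ) : ℂ)
        * ((Finset.univ.filter fun β : U → ZQ Q => 2 * twistShift n p₁ Q U bk b β i.1.1 = ĝ β).card : ℂ)
        * ((((((p₁ * Q : ℕ+) : ℕ)) * ((D * D * (p₁ * Q) : ℕ+) : ℕ) ^ (n + 1)) ^ Fintype.card κ : ℕ) : ℂ) := by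
  have h1 := POVM.prodFst_weight_tmul (Y := κ → (Fin (n + 1) → ZN D p₁ Q))
    (datumReadoutPrior n D p₁ Q hP U bk v' hunit ĝ) (datumKet n D p₁ Q U bk b v' a i.1)
    (fun z : κ → (Fin (n + 1) → ZN D p₁ Q) => ∏ k, siblingKet n D p₁ Q U bk b (w k) i.1.1 (i.2 k) (z k)) a
  rw [datumReadoutPrior_weight n D p₁ Q hP U bk b v' hb hbkU hbk hunit ĝ,
    siblings_normSq n D p₁ Q hP U bk b w i.1.1 i.2] at h1
  exact h1

/-- **The `μ`-weighted weight of the joint prior read-out**: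
`Q^{n+2}·c·(Σ_β F_μ(β, ĝ(β))) · (Q^{n+2})^{#κ}·(P·N^{n+1})^{#κ}`.
[cite: ChenQuantumLattice2024, §3.5.9 pp. 35–38, §3.6 p. 38, eq. (12) p. 17] -/
theorem joint_datum_prior_weight_attained (hP : Odd ((p₁ * Q : ℕ+) : ℕ)) (U : Finset (Fin (n + 1)))
    (bk b v' : Fin (n + 1) → ℤ)
    (hb : ∀ i ∈ U, ((p₁ : ℕ) : ℤ) ∣ b i) (hbkU : ∀ i ∈ U, ((p₁ : ℕ) : ℤ) ∣ bk i)
    (hbk : ∀ i, i ∉ U → bk i = b i) (hunit : ∃ i₀, i₀ ∉ U ∧ IsUnit ((bk i₀ : ℤ) : ZQ Q))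
    (w : κ → Fin (n + 1) → ℤ) (μ : (Fin (n + 1) → ZQ Q) → ℝ) (ĝ : (U → ZQ Q) → ZQ Q) :
    (∑ a, ∑ i : ((Fin (n + 1) → ZQ Q) × (Fin (n + 1) → ZQ Q)) × (κ → ZQ Q × (Fin (n + 1) → ZQ Q)),
        (μ i.1.1 : ℂ) * (jointReadoutPrior n D p₁ Q hP U bk v' hunit ĝ).weight
          (jointDatumKet n D p₁ Q U bk b v' w a i) a).re
      = (((Q : ℕ+) : ℕ) : ℝ) ^ (n + 1) * (((Q : ℕ+) : ℕ) : ℝ) * blockConst n D p₁ Q U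
          * (∑ β, priorFiber n p₁ Q U bk b μ β (ĝ β))
        * (((((Q : ℕ+) : ℕ) : ℝ) * (((Q : ℕ+) : ℕ) : ℝ) ^ (n + 1)) ^ Fintype.card κ
          * ((((p₁ * Q : ℕ+) : ℕ) : ℝ) * (((D * D * (p₁ * Q) : ℕ+) : ℕ) : ℝ) ^ (n + 1))
              ^ Fintype.card κ) := by
  classical
  obtain ⟨F, hF⟩ : ∃ F : (Fin (n + 1) → ZQ Q) → ℝ, ∀ s, F s = μ s * (blockConst n D p₁ Q U
      * ((Finset.univ.filter fun β : U → ZQ Q => 2 * twistShift n p₁ Q U bk b β s = ĝ β).card : ℝ))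
      * ((((p₁ * Q : ℕ+) : ℕ) : ℝ) * (((D * D * (p₁ * Q) : ℕ+) : ℕ) : ℝ) ^ (n + 1))
          ^ Fintype.card κ :=
    ⟨_, fun s => rfl⟩
  have hC : ∀ (a : ZQ Q)
      (i : ((Fin (n + 1) → ZQ Q) × (Fin (n + 1) → ZQ Q)) × (κ → ZQ Q × (Fin (n + 1) → ZQ Q))),
      (μ i.1.1 : ℂ) * (jointReadoutPrior n D p₁ Q hP U bk v' hunit ĝ).weight
          (jointDatumKet n D p₁ Q U bk b v' w a i) a
        = ((F i.1.1 : ℝ) : ℂ) := by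
    intro a i
    rw [jointReadoutPrior_weight n D p₁ Q hP U bk b v' hb hbkU hbk hunit w ĝ a i, hF]
    push_cast
    ring
  simp_rw [hC, ← Complex.ofReal_sum]
  rw [Complex.ofReal_re, Finset.sum_const, Finset.card_univ, ZMod.card, nsmul_eq_mul, Fintype.sum_prod_type]
  dsimp only
  simp only [Finset.sum_const, Finset.card_univ, nsmul_eq_mul]
  rw [Fintype.sum_prod_type]
  dsimp only
  simp only [Finset.sum_const, Finset.card_univ, Fintype.card_prod, Fintype.card_fun, ZMod.card,
    Fintype.card_fin, nsmul_eq_mul]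
  have hswap : ∑ β, priorFiber n p₁ Q U bk b μ β (ĝ β)
      = ∑ s, μ s * ((Finset.univ.filter fun β : U → ZQ Q =>
          2 * twistShift n p₁ Q U bk b β s = ĝ β).card : ℝ) := by
    unfold priorFiber
    simp_rw [Finset.sum_filter, Finset.card_filter]
    push_cast
    rw [Finset.sum_comm]
    refine Finset.sum_congr rfl fun s _ => ?_
    rw [Finset.mul_sum]
    refine Finset.sum_congr rfl fun β _ => ?_
    split_ifs
    · rw [mul_one]
    · rw [mul_zero]
  rw [hswap]
  simp only [Finset.mul_sum, Finset.sum_mul]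
  refine Finset.sum_congr rfl fun s _ => ?_
  rw [hF]
  push_cast
  ring

/-! ### 5. The exact joint optimum under every prior -/

/-- **T16 (attainment).**  With the Bayes guess table `ĝ(β) ∈ argmax_g F_μ(β, g)` the joint prior
read-out guesses run `0`'s datum with `μ`-average probability EXACTLY `V_μ`.
[cite: ChenQuantumLattice2024, §3.5.9 pp. 35–38, §3.6 p. 38; NielsenChuang2010, Box 2.3 p. 87] -/
theorem joint_datum_prior_success_prob_eq_value (hP : Odd ((p₁ * Q : ℕ+) : ℕ))
    (U : Finset (Fin (n + 1))) (bk b v' : Fin (n + 1) → ℤ)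
    (hb : ∀ i ∈ U, ((p₁ : ℕ) : ℤ) ∣ b i) (hbkU : ∀ i ∈ U, ((p₁ : ℕ) : ℤ) ∣ bk i)
    (hbk : ∀ i, i ∉ U → bk i = b i) (hunit : ∃ i₀, i₀ ∉ U ∧ IsUnit ((bk i₀ : ℤ) : ZQ Q))
    (w : κ → Fin (n + 1) → ℤ) (μ : (Fin (n + 1) → ZQ Q) → ℝ) (hμ : 0 < ∑ s, μ s) :
    ∃ ĝ : (U → ZQ Q) → ZQ Q,
      (∑ a, ∑ i : ((Fin (n + 1) → ZQ Q) × (Fin (n + 1) → ZQ Q)) × (κ → ZQ Q × (Fin (n + 1) → ZQ Q)),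
          (μ i.1.1 : ℂ) * (jointReadoutPrior n D p₁ Q hP U bk v' hunit ĝ).weight
            (jointDatumKet n D p₁ Q U bk b v' w a i) a).re
          / (∑ a : ZQ Q,
              ∑ i : ((Fin (n + 1) → ZQ Q) × (Fin (n + 1) → ZQ Q)) × (κ → ZQ Q × (Fin (n + 1) → ZQ Q)),
              (μ i.1.1 : ℂ) * (star (jointDatumKet n D p₁ Q U bk b v' w a i)
                ⬝ᵥ jointDatumKet n D p₁ Q U bk b v' w a i)).re
        = priorValue n p₁ Q U bk b μ := by
  classical
  have hex : ∀ β : U → ZQ Q, ∃ g : ZQ Q,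
      Finset.univ.sup' Finset.univ_nonempty (priorFiber n p₁ Q U bk b μ β)
        = priorFiber n p₁ Q U bk b μ β g := by
    intro β
    obtain ⟨g, -, hg⟩ := Finset.exists_mem_eq_sup' Finset.univ_nonempty (priorFiber n p₁ Q U bk b μ β)
    exact ⟨g, hg⟩
  choose ĝ hĝ using hex
  refine ⟨ĝ, ?_⟩
  have hQ : (0 : ℝ) < ((Q : ℕ+) : ℕ) := by exact_mod_cast PNat.pos Q
  have hP' : (0 : ℝ) < ((p₁ * Q : ℕ+) : ℕ) := by exact_mod_cast PNat.pos _
  have hN : (0 : ℝ) < ((D * D * (p₁ * Q) : ℕ+) : ℕ) := by exact_mod_cast PNat.pos _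
  have hT : (0 : ℝ) < ((((Q : ℕ+) : ℕ) : ℝ) * (((Q : ℕ+) : ℕ) : ℝ) ^ (n + 1)) ^ Fintype.card κ
      * ((((p₁ * Q : ℕ+) : ℕ) : ℝ) * (((D * D * (p₁ * Q) : ℕ+) : ℕ) : ℝ) ^ (n + 1))
          ^ Fintype.card κ :=
    mul_pos (pow_pos (mul_pos hQ (pow_pos hQ _)) _) (pow_pos (mul_pos hP' (pow_pos hN _)) _)
  rw [joint_datum_prior_weight_attained n D p₁ Q hP U bk b v' hb hbkU hbk hunit w μ ĝ,
    joint_datum_prior_totalWeight n D p₁ Q hP]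
  unfold priorValue
  simp_rw [hĝ]
  rw [div_eq_div_iff
    (mul_pos (mul_pos (mul_pos (mul_pos hQ (pow_pos hQ _)) hμ) (mul_pos hP' (pow_pos hN _))) hT).ne'
    (mul_pos hμ (pow_pos hQ _)).ne', ← blockConst_mul_pow n D p₁ Q U]
  ring

/-- **T16: the exact JOINT optimum under EVERY prior on the unknown coordinates.**  For every weight
`μ ≥ 0`, `Σμ > 0`, on the common secret shift (run `0`'s datum and offset shift and the siblings' data
uniform — they ARE uniform and secret-independent, Steps 1–8), the greatest `μ`-average probability,
over ALL POVMs on the JOINT Step-9 registers `ℤ_N^{n+1} × (κ → ℤ_N^{n+1})` of run `0` and of any finite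
family `κ` of sibling runs sharing the secret, of outputting run `0`'s datum is EXACTLY the one-register
prior value `V_μ = E_β max_g Pr_μ[2τ(β, s) = g]` of T15: neither the siblings nor a prior on the short
secret, nor both together, buy more than ONE noiseless random inner product of the unknown coordinates.
[cite: ChenQuantumLattice2024, §3.5.9 pp. 35–38, §3.6 p. 38, eq. (12) p. 17; NielsenChuang2010, §2.2.6
p. 90, Box 2.3 p. 87, §2.4.1 p. 99] -/
theorem joint_datum_prior_isGreatest (hP : Odd ((p₁ * Q : ℕ+) : ℕ)) (U : Finset (Fin (n + 1)))
    (bk b v' : Fin (n + 1) → ℤ)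
    (hb : ∀ i ∈ U, ((p₁ : ℕ) : ℤ) ∣ b i) (hbkU : ∀ i ∈ U, ((p₁ : ℕ) : ℤ) ∣ bk i)
    (hbk : ∀ i, i ∉ U → bk i = b i) (hunit : ∃ i₀, i₀ ∉ U ∧ IsUnit ((bk i₀ : ℤ) : ZQ Q))
    (w : κ → Fin (n + 1) → ℤ) (μ : (Fin (n + 1) → ZQ Q) → ℝ) (hμ : 0 < ∑ s, μ s) :
    IsGreatest (Set.range fun E : POVM ((Fin (n + 1) → ZN D p₁ Q) × (κ → (Fin (n + 1) → ZN D p₁ Q))) (ZQ Q) =>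
        (∑ a, ∑ i : ((Fin (n + 1) → ZQ Q) × (Fin (n + 1) → ZQ Q)) × (κ → ZQ Q × (Fin (n + 1) → ZQ Q)),
            (μ i.1.1 : ℂ) * E.weight (jointDatumKet n D p₁ Q U bk b v' w a i) a).re
          / (∑ a : ZQ Q,
              ∑ i : ((Fin (n + 1) → ZQ Q) × (Fin (n + 1) → ZQ Q)) × (κ → ZQ Q × (Fin (n + 1) → ZQ Q)),
              (μ i.1.1 : ℂ) * (star (jointDatumKet n D p₁ Q U bk b v' w a i)
                ⬝ᵥ jointDatumKet n D p₁ Q U bk b v' w a i)).re)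
      (priorValue n p₁ Q U bk b μ) := by
  obtain ⟨ĝ, hĝ⟩ :=
    joint_datum_prior_success_prob_eq_value n D p₁ Q hP U bk b v' hb hbkU hbk hunit w μ hμ
  refine ⟨⟨jointReadoutPrior n D p₁ Q hP U bk v' hunit ĝ, hĝ⟩, ?_⟩
  rintro _ ⟨E, rfl⟩
  exact joint_datum_prior_success_prob_le_value n D p₁ Q hP U bk b v' hb hbkU hbk hunit w μ hμ E

/-- **Siblings are worthless under every prior (T16 = T15).**  The supremum over ALL joint POVMs of the
`μ`-average success probability for run `0`'s datum equals the supremum over the POVMs of run `0`'s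
register ALONE — both are `V_μ`. [cite: ChenQuantumLattice2024, §3.5.9 pp. 35–38, §3.6 p. 38] -/
theorem joint_datum_prior_value_eq_single (hP : Odd ((p₁ * Q : ℕ+) : ℕ)) (U : Finset (Fin (n + 1)))
    (bk b v' : Fin (n + 1) → ℤ)
    (hb : ∀ i ∈ U, ((p₁ : ℕ) : ℤ) ∣ b i) (hbkU : ∀ i ∈ U, ((p₁ : ℕ) : ℤ) ∣ bk i)
    (hbk : ∀ i, i ∉ U → bk i = b i) (hunit : ∃ i₀, i₀ ∉ U ∧ IsUnit ((bk i₀ : ℤ) : ZQ Q))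
    (w : κ → Fin (n + 1) → ℤ) (μ : (Fin (n + 1) → ZQ Q) → ℝ) (hμ : 0 < ∑ s, μ s) :
    sSup (Set.range fun E : POVM ((Fin (n + 1) → ZN D p₁ Q) × (κ → (Fin (n + 1) → ZN D p₁ Q))) (ZQ Q) =>
        (∑ a, ∑ i : ((Fin (n + 1) → ZQ Q) × (Fin (n + 1) → ZQ Q)) × (κ → ZQ Q × (Fin (n + 1) → ZQ Q)),
            (μ i.1.1 : ℂ) * E.weight (jointDatumKet n D p₁ Q U bk b v' w a i) a).re
          / (∑ a : ZQ Q,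
              ∑ i : ((Fin (n + 1) → ZQ Q) × (Fin (n + 1) → ZQ Q)) × (κ → ZQ Q × (Fin (n + 1) → ZQ Q)),
              (μ i.1.1 : ℂ) * (star (jointDatumKet n D p₁ Q U bk b v' w a i)
                ⬝ᵥ jointDatumKet n D p₁ Q U bk b v' w a i)).re)
      = sSup (Set.range fun E : POVM (Fin (n + 1) → ZN D p₁ Q) (ZQ Q) =>
        (∑ a, ∑ sc : (Fin (n + 1) → ZQ Q) × (Fin (n + 1) → ZQ Q),
            (μ sc.1 : ℂ) * E.weight (datumKet n D p₁ Q U bk b v' a sc) a).re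
          / (∑ a : ZQ Q, ∑ sc : (Fin (n + 1) → ZQ Q) × (Fin (n + 1) → ZQ Q),
              (μ sc.1 : ℂ) * (star (datumKet n D p₁ Q U bk b v' a sc)
                ⬝ᵥ datumKet n D p₁ Q U bk b v' a sc)).re) := by
  rw [(joint_datum_prior_isGreatest n D p₁ Q hP U bk b v' hb hbkU hbk hunit w μ hμ).csSup_eq,
    (datum_prior_isGreatest n D p₁ Q hP U bk b v' hb hbkU hbk hunit μ hμ).csSup_eq]

end JointPrior

end Literature.Computability.Cryptography.Chen2024

/-! ### 6. The `Steps` rendering: T16 for every admissible shape -/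

namespace Literature.Computability.Cryptography.Chen2024.Shape

open scoped BigOperators ComplexOrder
open Matrix

variable (S : Shape) {κ : Type*} [Fintype κ] [DecidableEq κ]

/-- **T16 for every admissible shape.**  Let `U ∌ 0` be the unknown coordinates, `bk` any PUBLIC vector
agreeing with `S.b` off `U` and `≡ 0 (mod p₁)` on `U`, `v′` any representative of run `0`'s offset
class, `w k` the sibling runs' offsets, and `μ` ANY weight (`Σμ > 0`) on the common secret shift — the
observer's prior on the unknown coordinates (LWE secret and noise entries).  Then the greatest
`μ`-average probability over ALL joint measurements of the Step-9 registers of run `0` and of the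
sibling runs of outputting run `0`'s datum is EXACTLY T15's one-register prior value `V_μ`.
[cite: ChenQuantumLattice2024, §3.5.9 pp. 35–38, §3.6 p. 38, eq. (12) p. 17, Cond. C.3–C.5 p. 18] -/
theorem joint_datum_privacy_prior (h : S.Admissible) (U : Finset (Fin (S.n + 1)))
    (hU : (0 : Fin (S.n + 1)) ∉ U) (bk : Fin (S.n + 1) → ℤ)
    (hbkU : ∀ i ∈ U, ((S.p₁ : ℕ) : ℤ) ∣ bk i) (hbk : ∀ i, i ∉ U → bk i = S.b i)
    (v' : Fin (S.n + 1) → ℤ) (w : κ → Fin (S.n + 1) → ℤ)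
    (μ : (Fin (S.n + 1) → ZQ S.Q) → ℝ) (hμ : 0 < ∑ s, μ s) :
    IsGreatest (Set.range fun E : POVM ((Fin (S.n + 1) → ZN S.D S.p₁ S.Q)
        × (κ → (Fin (S.n + 1) → ZN S.D S.p₁ S.Q))) (ZQ S.Q) =>
        (∑ a, ∑ i : ((Fin (S.n + 1) → ZQ S.Q) × (Fin (S.n + 1) → ZQ S.Q))
            × (κ → ZQ S.Q × (Fin (S.n + 1) → ZQ S.Q)),
            (μ i.1.1 : ℂ) * E.weight (jointDatumKet S.n S.D S.p₁ S.Q U bk S.b v' w a i) a).re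
          / (∑ a : ZQ S.Q, ∑ i : ((Fin (S.n + 1) → ZQ S.Q) × (Fin (S.n + 1) → ZQ S.Q))
              × (κ → ZQ S.Q × (Fin (S.n + 1) → ZQ S.Q)),
              (μ i.1.1 : ℂ) * (star (jointDatumKet S.n S.D S.p₁ S.Q U bk S.b v' w a i)
                ⬝ᵥ jointDatumKet S.n S.D S.p₁ S.Q U bk S.b v' w a i)).re)
      (priorValue S.n S.p₁ S.Q U bk S.b μ) :=
  joint_datum_prior_isGreatest S.n S.D S.p₁ S.Q h.odd_P U bk S.b v' (h.p₁_dvd_of_mem hU) hbkU hbk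
    (h.exists_unit_coord hU hbk) w μ hμ

/-- **The two extreme priors, jointly, for every admissible shape**: with no prior the joint optimum is
T14's `V(Q, #U)`; with a known secret it is `1` — the values `priorValue_one_eq_datumValue`,
`priorValue_single` of T15 carried to the joint setting by `joint_datum_privacy_prior`.
[cite: ChenQuantumLattice2024, §3.5.9 pp. 35–38, §3.6 p. 38, Cond. C.3 p. 18] -/
theorem joint_datum_privacy_prior_extremes (h : S.Admissible) (U : Finset (Fin (S.n + 1)))
    (hU : (0 : Fin (S.n + 1)) ∉ U) (bk : Fin (S.n + 1) → ℤ)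
    (hbkU : ∀ i ∈ U, ((S.p₁ : ℕ) : ℤ) ∣ bk i) (hbk : ∀ i, i ∉ U → bk i = S.b i)
    (v' : Fin (S.n + 1) → ℤ) (w : κ → Fin (S.n + 1) → ℤ) (s₀ : Fin (S.n + 1) → ZQ S.Q) :
    IsGreatest (Set.range fun E : POVM ((Fin (S.n + 1) → ZN S.D S.p₁ S.Q)
        × (κ → (Fin (S.n + 1) → ZN S.D S.p₁ S.Q))) (ZQ S.Q) =>
        (∑ a, ∑ i : ((Fin (S.n + 1) → ZQ S.Q) × (Fin (S.n + 1) → ZQ S.Q))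
            × (κ → ZQ S.Q × (Fin (S.n + 1) → ZQ S.Q)),
            ((if i.1.1 = s₀ then (1 : ℝ) else 0 : ℝ) : ℂ)
              * E.weight (jointDatumKet S.n S.D S.p₁ S.Q U bk S.b v' w a i) a).re
          / (∑ a : ZQ S.Q, ∑ i : ((Fin (S.n + 1) → ZQ S.Q) × (Fin (S.n + 1) → ZQ S.Q))
              × (κ → ZQ S.Q × (Fin (S.n + 1) → ZQ S.Q)),
              ((if i.1.1 = s₀ then (1 : ℝ) else 0 : ℝ) : ℂ)
                * (star (jointDatumKet S.n S.D S.p₁ S.Q U bk S.b v' w a i)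
                  ⬝ᵥ jointDatumKet S.n S.D S.p₁ S.Q U bk S.b v' w a i)).re)
      1 := by
  have hμ : (0 : ℝ) < ∑ s : Fin (S.n + 1) → ZQ S.Q, (if s = s₀ then (1 : ℝ) else 0) := by
    rw [Finset.sum_ite_eq' Finset.univ s₀, if_pos (Finset.mem_univ _)]
    exact one_pos
  have h1 := joint_datum_privacy_prior S h U hU bk hbkU hbk v' w (fun s => if s = s₀ then (1 : ℝ) else 0) hμ
  rwa [priorValue_single] at h1

end Literature.Computability.Cryptography.Chen2024.Shape
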